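import Summits.BirchSwinnertonDyer.BirchSwinnertonDyer.Theorems.EisensteinPrimesMazurMCOnCellBTwistbackKLFlatPartner
import Summits.BirchSwinnertonDyer.Rank1Residual.X11b.BDPRouteLocalIndexTorsion
import Summits.BirchSwinnertonDyer.Rank1Residual.X11b.RouteR1LogOmega
import Summits.BirchSwinnertonDyer.Rank1Residual.O5.HeegnerLogTransportThreeChain
import Literature.NumberTheory.EllipticCurves.KrizLi2019.EisensteinHeegnerLog
import Literature.NumberTheory.EllipticCurves.LFunctionPrimeCoeffMultiplicative
import Literature.NumberTheory.EllipticCurves.LocalTorsionMultiplicativeProofs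
import HarnessLib

/-!
# Crux 3 `MazurMCOnCellB` (stmt-BirchSwinnertonDyer-19033), line `twistback` v4 — STEP L IS FREE ON THE KRIZ–LI
# LOCUS: at a NON-split multiplicative Eisenstein pair Kriz–Li 2019 Thm. 1.20 makes the Heegner point `p`-PRIMITIVE
# in `E(K)`, so `X11b.IndexLowerBoundAt W p K P` (the `hlow` input of the per-pair door p645525 §2 — today item
# -27489 / Keller–Yin Thm. D, a PREPRINT) holds with left side `0`

Width seat bsd-line-x2-p1-w8 g0 (2026-08-28), `--supports stmt-BirchSwinnertonDyer-19033 --as helper`. HONEST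
FRAMING (cell `bsd-eis`): conditional theorems only; inputs BY NAME = the route's `PublishedInputs` (stmt-…-19037),
Disegni 2020 Thm. 4(1), Greenberg–Vatsal Thm. (3.11) and **Kriz–Li 2019 Thm. 1.20**
(`KrizLi2019.thm120_padicLogHeegner_unit_of_bernoulli`, Forum Math. Sigma 7 (2019) e15, PUBLISHED; typed in the
tree; "does not require `p ∤ N`"); nothing booked; no main conjecture / BSD proved for any curve unconditionally;
no summit statement is proved; 0 cells / labels / tiers move; no definition, no named fact, no `sorry`.

The door p645525 §2 (`…KLFlatPartner.mazurMainConjectureAt_of_cellB_of_not_split_of_indexLowerBoundAt_of_klFlat_twist`)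
takes per pair: STEP L at ONE Heegner datum (`hlow : Finite Ш(E/K) → X11b.IndexLowerBoundAt W p K P`, i.e.
`2·ord_p [E(K) : ℤP] ≤ ord_p #Ш(E/K) + 2·ord_p ∏ c_ℓ`), the twist's analytic rank (`hrd`) and a KL-flat carrier.
Where Kriz–Li Thm. 1.20 applies to `(E, K)` — the same class-number data the KL-flat carrier is read from (for
the A10 non-split cells, `ψ_E = χ_D`: the Bernoulli pair is `{B_{1,χ_{D d_K}}, B_{1,χ_{−3D}}}`) — STEP L is free:

* §1 `padicLogOmega_ne_zero_and_padicLogOrd_le_one_of_krizLi`: at a NON-split multiplicative `p` the displayed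
  conclusion `(|Ẽ^{ns}(𝔽_p)|/p)·(log_{ω_𝓔} P/c) ≢ 0 (mod p)`, with `|Ẽ^{ns}(𝔽_p)| = p + 1` (Rem. 1.17, `a_p = −1`)
  and `p ∤ c`, gives `log_{ω_𝓔} P ≠ 0` and **`ord_p log_{ω_𝓔} P ≤ 1`** (valuation bookkeeping only).
* §2 `padicValNat_index_eq_zero_of_padicLogOrd_le_one`: then **`p ∤ [E(K) : ℤP]`** — on the cell's line
  `Ψ : E(ℚ_p) → ℤ_p` (Castella (calcul) / JSW (7.1.5), `X11b.LocalIndex.exists_addEquiv_valuation_psi_padicPointOf`)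
  `v(Ψ P_ι) = ord_p log_{ω_𝓔} P + ord_p c_p + ord_p #Ẽ_ns − 1 = ord_p log_{ω_𝓔} P − 1 ≥ 0` is `0`, while
  `v(Ψ(p•Q)) ≥ 1`; `E(K)[p] = 0` since `E(ℚ_p)[p] = 0` at a non-split `p ≥ 3`
  (`LocalTorsionMult.localTorsion_eq_zero_of_nonsplit`); Cauchy in `E(K)/ℤP` (`O5…padicValNat_index_zmultiples_eq_zero`).
* §3 `indexLowerBoundAt_of_padicValNat_index_eq_zero` (left side `0`) and `indexLowerBoundAt_of_thm120`: the same
  BY NAME from the named fact at a Heegner datum carrying Kriz–Li's binders (primitive `ψ` of conductor `f`,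
  Teichmüller `ω`, trace form of `E[p]^{ss} ≅ 𝔽_p(ψ) ⊕ 𝔽_p(ψ⁻¹ω)`, (1) `ψ(p) ≠ 1 ≠ (ψ⁻¹ω)(p)`, (2) no split
  multiplicative prime, (3) the additive-prime condition, `ε_K`, (4) `B_{1,ψ₀⁻¹ε_K}·B_{1,ψ₀ω⁻¹} ≢ 0 (mod p)`);
  `P` is of infinite order.
* §4 `mazurMainConjectureAt_of_cellB_of_not_split_of_thm120_of_klFlat_twist`: **the door with `hlow`
  DISCHARGED** — Mazur's MC at a NON-split X2b pair from `PublishedInputs`, Disegni Thm. 4(1), GV Thm. (3.11),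
  Kriz–Li Thm. 1.20 (ALL PUBLISHED), ONE admissible `K` with Kriz–Li's binders, the twist's analytic rank (`hrd`,
  kept; seat w6 discharges it from the same binders) and a KL-flat carrier: NO Keller–Yin Thm. D on this locus.

Not done here: the supply of `K` (Kriz–Li Thm. 9.4; seat w6), the twist's line characters (F1–F3), split pairs.
References: [KrizLi2019] Thm. 1.20 (pp. 7–8) = Thm. 7.1 (pp. 42–43), Rem. 1.17 (p. 6); [Castella2018] proof of
Thm. 2.3, (calcul) (arXiv:1704.06608 p. 6); [JetchevSkinnerWan2017] §7.1 (7.1.5), §7.4.1 (eq:shalowerK-1)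
(arXiv:1512.06894 pp. 16, 30); [SilvermanAEC2009] VII.6.1, Ex. 3.5, IV.6.4; [GreenbergVatsal2000] §3 Thm. (3.11);
[Disegni2020] Thm. 4 (§3.2).
-/

set_option autoImplicit false
-- `Summit.BirchSwinnertonDyer.BirchSwinnertonDyer.…`: the summit and its single sub-problem share a name.
set_option linter.dupNamespace false

noncomputable section

open scoped Classical MatrixGroups ModularForm

open CongruenceSubgroup WeierstrassCurve NumberField IsDedekindDomain Field
  Literature.NumberTheory.EllipticCurves Literature.NumberTheory.GaloisRepresentations
  Literature.NumberTheory.EllipticCurves.ModularForms Literature.NumberTheory.EllipticCurves.Rank1Residual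
  Literature.NumberTheory.EllipticCurves.Rank1Residual.Typed Literature.NumberTheory.EllipticCurves.Wuthrich2014
  Literature.NumberTheory.EllipticCurves.GreenbergVatsal2000 Literature.NumberTheory.EllipticCurves.Disegni2020
  Summit.BirchSwinnertonDyer.Rank1Residual Summit.BirchSwinnertonDyer.BirchSwinnertonDyer.Theses
  Summit.BirchSwinnertonDyer.BirchSwinnertonDyer.Theorems.EisensteinPrimesMazurMCOnCellBTwistbackKLFlatPartner

namespace Summit.BirchSwinnertonDyer.BirchSwinnertonDyer.Theorems.EisensteinPrimesMazurMCOnCellBTwistbackKrizLiStepL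

/-! ## §1. Kriz–Li's conclusion in `ord_p` bookkeeping at a NON-split multiplicative prime -/

section Valuation

variable (W : WeierstrassCurve ℚ) [W.IsElliptic] [W.IsGloballyMinimal] (p : ℕ) [Fact p.Prime]

omit [W.IsGloballyMinimal] in
/-- **`|Ẽ^{ns}(𝔽_p)| = p + 1` at a NON-split multiplicative prime** (Kriz–Li Rem. 1.17: `ℓ + 1` at a non-split
`ℓ ∥ N`), for the reading `KrizLi2019.nsPointCount W p = p + [good] − a_p(W)`: `a_p = −1`
(`LFunction_apply_prime_of_hasMultiplicativeReductionAtPrime_of_not_split`, Silverman Ex. 8.19(a)) and a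
multiplicative prime is not good. [cite: KrizLi2019, Rem. 1.17 (p. 6)] [cite: SilvermanAEC2009, Exercise 8.19(a) (p. 230)] -/
theorem nsPointCount_eq_of_not_split (hmult : W.HasMultiplicativeReductionAtPrime p)
    (hns : ¬ W.HasSplitMultiplicativeReductionAtPrime p) :
    KrizLi2019.nsPointCount W p = p + 1 := by
  have ha : W.LFunction p = -1 :=
    W.LFunction_apply_prime_of_hasMultiplicativeReductionAtPrime_of_not_split p hmult hns
  have hng : ¬ W.HasGoodReductionAtPrime p :=
    WeierstrassCurve.HasMultiplicativeReduction.not_hasGoodReduction (R := ℤ_[p]) hmult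
  unfold KrizLi2019.nsPointCount
  rw [dif_pos (Fact.out : p.Prime), ha]
  simp [hng]

variable {K : Type} [Field K] [NumberField K] {ιp : K →+* ℚ_[p]} {P : (W.baseChange K).toAffine.Point}
  {c : ℤ}

/-- The cell's `X11b.padicLogOrd` and the Literature reading `padicLogOrd` have the same body. [folklore] -/
theorem x11b_padicLogOrd_eq : X11b.padicLogOrd W p ιp P =
    Literature.NumberTheory.EllipticCurves.padicLogOrd W p ιp P :=
  rfl

variable {W p} in
/-- **Kriz–Li's displayed conclusion ⟹ `log_{ω_𝓔} P ≠ 0` and `ord_p log_{ω_𝓔} P ≤ 1` at a NON-split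
multiplicative `p` with `p ∤ c`**: `¬ ‖(|Ẽ^{ns}(𝔽_p)|/p) · (log_{ω_𝓔} P / c)‖ ≤ p⁻¹` with `|Ẽ^{ns}(𝔽_p)| = p + 1`
and `c` `p`-units gives `‖log_{ω_𝓔} P‖ > p⁻²` (`log_{ω_𝓔} = Castella2018.padicLogOmega`; its `ord_p` is the cell's
`X11b.padicLogOrd`, `Castella2018.valuation_padicLogOmega`). Only the direction «not `0 mod p`» is used.
[cite: KrizLi2019, Thm. 1.20 (p. 8) and Rem. 1.17 (p. 6)] [cite: Castella2018, Thm. 2.3 (arXiv:1704.06608 p. 5)] -/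
theorem padicLogOmega_ne_zero_and_padicLogOrd_le_one_of_krizLi
    (hmult : W.HasMultiplicativeReductionAtPrime p) (hns : ¬ W.HasSplitMultiplicativeReductionAtPrime p)
    (hc : ¬ (p : ℤ) ∣ c)
    (hne : ¬ ‖((KrizLi2019.nsPointCount W p : ℤ) : ℚ_[p]) / (p : ℚ_[p]) *
        (Castella2018.padicLogOmega W p ιp P / (c : ℚ_[p]))‖ ≤ (p : ℝ)⁻¹) :
    Castella2018.padicLogOmega W p ιp P ≠ 0 ∧ X11b.padicLogOrd W p ιp P ≤ 1 := by
  set L := Castella2018.padicLogOmega W p ιp P with hL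
  have hp : p.Prime := Fact.out
  have hp0 : (p : ℚ_[p]) ≠ 0 := mod_cast hp.ne_zero
  have hnsv : KrizLi2019.nsPointCount W p = p + 1 := nsPointCount_eq_of_not_split W p hmult hns
  -- the four factors are non-zero
  have hL0 : L ≠ 0 := by intro h0; apply hne; rw [h0, zero_div, mul_zero, norm_zero]; positivity
  have hc0' : (c : ℚ_[p]) ≠ 0 := by intro h0; apply hne; rw [h0, div_zero, mul_zero, norm_zero]; positivity
  have hn0' : (((p : ℤ) + 1 : ℤ) : ℚ_[p]) ≠ 0 := by
    intro h0; apply hne; rw [hnsv, h0, zero_div, zero_mul, norm_zero]; positivity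
  refine ⟨hL0, ?_⟩
  -- valuations of the integer factors
  have hvc : ((c : ℚ_[p])).valuation = 0 := by
    rw [Padic.valuation_intCast]; exact_mod_cast padicValInt.eq_zero_of_not_dvd hc
  have hvn : ((((p : ℤ) + 1 : ℤ) : ℚ_[p])).valuation = 0 := by
    rw [Padic.valuation_intCast]
    have hnd : ¬ (p : ℤ) ∣ (p : ℤ) + 1 := by
      intro h
      have h1 : (p : ℤ) ∣ 1 := by simpa using (Int.dvd_add_right (dvd_refl (p : ℤ))).mp h
      exact hp.one_lt.ne' (by exact_mod_cast Int.eq_one_of_dvd_one (by positivity) h1)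
    exact_mod_cast padicValInt.eq_zero_of_not_dvd hnd
  -- the displayed quantity is non-zero with valuation `ord_p L − 1`
  set e : ℚ_[p] := ((KrizLi2019.nsPointCount W p : ℤ) : ℚ_[p]) / (p : ℚ_[p]) * (L / (c : ℚ_[p])) with he
  have he' : e = (((p : ℤ) + 1 : ℤ) : ℚ_[p]) / (p : ℚ_[p]) * (L / (c : ℚ_[p])) := by rw [he, hnsv]
  have he0 : e ≠ 0 := by rw [he']; exact mul_ne_zero (div_ne_zero hn0' hp0) (div_ne_zero hL0 hc0')
  have hve : e.valuation = X11b.padicLogOrd W p ιp P - 1 := by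
    rw [he', Padic.valuation_mul (div_ne_zero hn0' hp0) (div_ne_zero hL0 hc0'), div_eq_mul_inv,
      div_eq_mul_inv, Padic.valuation_mul hn0' (inv_ne_zero hp0), Padic.valuation_mul hL0 (inv_ne_zero hc0'),
      Padic.valuation_inv, Padic.valuation_inv, Padic.valuation_p, hvn, hvc,
      Castella2018.valuation_padicLogOmega hL0, x11b_padicLogOrd_eq]
    ring
  -- `¬ p^{-v(e)} ≤ p^{-1}` forces `v(e) ≤ 0`
  have hp1 : (1 : ℝ) < p := mod_cast hp.one_lt
  rw [Padic.norm_eq_zpow_neg_valuation he0] at hne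
  have hlt : (-1 : ℤ) < -e.valuation := by
    by_contra hle; apply hne
    calc (p : ℝ) ^ (-e.valuation) ≤ (p : ℝ) ^ (-1 : ℤ) := zpow_le_zpow_right₀ hp1.le (not_lt.mp hle)
      _ = (p : ℝ)⁻¹ := zpow_neg_one _
  rw [hve] at hlt
  omega

end Valuation

/-! ## §2. A `p`-primitive point: `ord_p log_{ω_𝓔} P ≤ 1` at a non-split multiplicative `p ≥ 3` ⟹ `p ∤ [E(K) : ℤP]` -/

section Index

variable (W : WeierstrassCurve ℚ) [W.IsElliptic] [W.IsGloballyMinimal] (p : ℕ) [Fact p.Prime]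
  {K : Type} [Field K] [NumberField K]

/-- **`E(K)[p] = 0` at a NON-split multiplicative `p ≥ 3`** for any number field `K` embedded in `ℚ_p`:
`E(ℚ_p)[p] = 0` (`c_p ∈ {1,2}`, `#Ẽ_ns(𝔽_p) = p + 1`, `E₁(ℚ_p)[p] = 0`;
`LocalTorsionMult.localTorsion_eq_zero_of_nonsplit`, Silverman VII.6.1 / Ex. 3.5 / VII.3.1) and `P ↦ P_ι` is an
injective homomorphism. [cite: SilvermanAEC2009, Thm VII.6.1, Exercise 3.5 and VII.3 Prop. 3.1] -/
theorem nsmul_eq_zero_imp_eq_zero_of_not_split (hp3 : 3 ≤ p) (hmult : W.HasMultiplicativeReductionAtPrime p)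
    (hns : ¬ W.HasSplitMultiplicativeReductionAtPrime p) (ιp : K →+* ℚ_[p]) :
    ∀ R : (W.baseChange K).toAffine.Point, p • R = 0 → R = 0 := by
  intro R hR
  have h0 : X11b.padicPointOf W p ιp R = 0 := by
    refine LocalTorsionMult.localTorsion_eq_zero_of_nonsplit W p hp3 hmult hns _ ?_
    unfold X11b.padicPointOf
    rw [← map_nsmul, hR, map_zero]
  apply WeierstrassCurve.Affine.Point.map_injective (f := ιp.toRatAlgHom)
  rw [map_zero]; exact h0

/-- **A `p`-PRIMITIVE point.** For `W/ℚ` globally minimal, `p ≥ 3` NON-split multiplicative, `ι_p : K → ℚ_p` and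
`P ∈ E(K)` of infinite order with `ord_p log_{ω_𝓔} P ≤ 1`: **`p ∤ [E(K) : ℤP]`** (index `0` = infinite allowed).
On the cell's line `Ψ : E(ℚ_p) → ℤ_p` (`X11b.LocalIndex.exists_addEquiv_valuation_psi_padicPointOf`, Castella's
(calcul) / JSW (7.1.5)) `v(Ψ P_ι) = ord_p log_{ω_𝓔} P + ord_p c_p + ord_p #Ẽ_ns − 1 = ord_p log_{ω_𝓔} P − 1 ≥ 0` is
`0`, while `v(Ψ(p • Q_ι)) ≥ 1` (`valuation_psi_zsmul_add`); with `E(K)[p] = 0` Cauchy in `E(K)/ℤP` concludes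
(`O5…padicValNat_index_zmultiples_eq_zero`). [cite: Castella2018, proof of Thm. 2.3, (calcul) (arXiv:1704.06608 p. 6)]
[cite: JetchevSkinnerWan2017, §7.1 (7.1.5) (arXiv:1512.06894 p. 16)] [cite: SilvermanAEC2009, Thm VII.6.1 and Exercise 3.5] -/
theorem padicValNat_index_eq_zero_of_padicLogOrd_le_one (hp3 : 3 ≤ p)
    (hmult : W.HasMultiplicativeReductionAtPrime p) (hns : ¬ W.HasSplitMultiplicativeReductionAtPrime p)
    (ιp : K →+* ℚ_[p]) (P : (W.baseChange K).toAffine.Point) (hP : ¬ IsOfFinAddOrder P)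
    (hlog : X11b.padicLogOrd W p ιp P ≤ 1) :
    padicValNat p (AddSubgroup.zmultiples P).index = 0 := by
  have hp : p.Prime := Fact.out
  haveI : ((W.baseChange ℚ_[p]).formalFiltration 2).FiniteIndex :=
    (W.baseChange ℚ_[p]).finiteIndex_formalFiltration 2
  obtain ⟨φ, hφ⟩ := X11b.LocalIndex.exists_addEquiv_valuation_psi_padicPointOf W p (K := K)
  have hPι : ¬ IsOfFinAddOrder (X11b.padicPointOf W p ιp P) :=
    O5.HeegnerLogTransport.not_isOfFinAddOrder_padicPointOf W p ιp P hP
  have hc : ¬ p ∣ (W.baseChange ℚ_[p]).localTamagawaNumber ℤ_[p] :=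
    LocalTorsionMult.not_dvd_localTamagawaNumber_padic_of_mult W p hp3 hmult (Or.inl hns)
  have hred : ¬ p ∣ reductionPointCount W p := LocalTorsionMult.not_dvd_reductionPointCount_of_mult W p hmult
  -- `v(Ψ P_ι) = ord_p log P − 1 ≥ 0`, hence `= 0`
  have eP := hφ ιp P hPι
  rw [padicValNat.eq_zero_of_not_dvd hc, padicValNat.eq_zero_of_not_dvd hred, Nat.cast_zero, add_zero,
    add_zero] at eP
  have hv0 : ((X11b.LocalIndex.psi ((W.baseChange ℚ_[p]).formalFiltration 2) φ
      (X11b.padicPointOf W p ιp P)).valuation : ℤ) = 0 := by omega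
  -- `P` is no `p`-th multiple in `E(K)`
  have hne : ∀ Q : (W.baseChange K).toAffine.Point, p • Q ≠ P := by
    intro Q hQ
    have hQι : ¬ IsOfFinAddOrder (X11b.padicPointOf W p ιp Q) := by
      intro h; apply hPι
      have : X11b.padicPointOf W p ιp P = p • X11b.padicPointOf W p ιp Q := by
        unfold X11b.padicPointOf; rw [← map_nsmul, hQ]
      rw [this]; exact h.nsmul
    have hp0 : ((p : ℕ) : ℤ) ≠ 0 := by exact_mod_cast hp.ne_zero
    have ht : IsOfFinAddOrder (0 : (W.baseChange ℚ_[p]).toAffine.Point) :=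
      (isOfFinAddOrder_iff_nsmul_eq_zero).mpr ⟨1, one_pos, by simp⟩
    have h1 := X11b.LocalIndex.valuation_psi_zsmul_add ((W.baseChange ℚ_[p]).formalFiltration 2) φ hQι ht hp0
    have h2 : ((p : ℕ) : ℤ) • X11b.padicPointOf W p ιp Q + 0 = X11b.padicPointOf W p ιp P := by
      rw [add_zero, natCast_zsmul]; unfold X11b.padicPointOf; rw [← map_nsmul, hQ]
    have h3 : padicValNat p (((p : ℕ) : ℤ).natAbs) = 1 := by simp
    rw [h2, h3] at h1
    have h4 : (X11b.LocalIndex.psi ((W.baseChange ℚ_[p]).formalFiltration 2) φ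
        (X11b.padicPointOf W p ιp P)).valuation = 0 := by exact_mod_cast hv0
    omega
  exact O5.HeegnerLogTransport.padicValNat_index_zmultiples_eq_zero
    (nsmul_eq_zero_imp_eq_zero_of_not_split W p hp3 hmult hns ιp) hne

end Index

/-! ## §3. STEP L at the datum: `X11b.IndexLowerBoundAt` with left side `0`, and the same from Thm. 1.20 BY NAME -/

section StepL

variable (W : WeierstrassCurve ℚ) (p : ℕ) [Fact p.Prime] (K : Type) [Field K] [NumberField K]
  (P : (W.baseChange K).toAffine.Point)

omit [Fact p.Prime] in
/-- **STEP L is free at a `p`-primitive point.** If `p ∤ [E(K) : ℤP]` then JSW's (eq:shalowerK-1) /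
Castella's (1.1) `2·ord_p [E(K) : ℤP_K] ≤ ord_p #Ш(E/K) + 2·ord_p ∏ c_ℓ` (`X11b.IndexLowerBoundAt W p K P`) holds
with left side `0` — no Ш, no Tamagawa number, no main conjecture. [cite: JetchevSkinnerWan2017, §7.4.1 (eq:shalowerK-1) (arXiv:1512.06894 p. 30)]
[cite: Castella2018, (1.1) (p. 2)] -/
theorem indexLowerBoundAt_of_padicValNat_index_eq_zero
    (h : padicValNat p (AddSubgroup.zmultiples P).index = 0) : X11b.IndexLowerBoundAt W p K P := by
  rw [X11b.indexLowerBoundAt_iff, h, mul_zero]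
  exact Nat.zero_le _

variable {W p K P}

/-- **STEP L at a Kriz–Li datum, from Kriz–Li 2019 Thm. 1.20 BY NAME.** For a globally minimal `W/ℚ`, an odd
prime `p` of multiplicative reduction, a Heegner datum `(N = N_W, K, Dt, H, ι, P)` (`K` imaginary quadratic with
the Heegner hypothesis for `N`, so `p` splits in `K`; `ι(P)` the Heegner point; `p ∤ c = Dt.c`), an embedding
`ι_p : K → ℚ_p` and Kriz–Li's binders — a primitive `ψ` of conductor `f` and the Teichmüller `ω` with
`E[p]^{ss} ≅ 𝔽_p(ψ) ⊕ 𝔽_p(ψ⁻¹ω)` in trace form at `ℓ ∤ pN`, (1) `ψ(p) ≠ 1 ≠ (ψ⁻¹ω)(p)`, (2) no prime of split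
multiplicative reduction (so `p` is NON-split), (3) the additive-prime condition, the Kronecker character `ε_K`,
(4) `B_{1,ψ₀⁻¹ε_K} · B_{1,ψ₀ω⁻¹} ≢ 0 (mod p)` —: **`P` has infinite order, `p ∤ [E(K) : ℤP]`, and
`X11b.IndexLowerBoundAt W p K P`** (§1 + §2; non-torsion by `X11b.R1.logOmega_eq_zero_iff`). CONDITIONAL on the
named fact `hKL`; item -27489 / Keller–Yin Thm. D is NOT used. [cite: KrizLi2019, Thm. 1.20 (pp. 7–8) = Thm. 7.1 (pp. 42–43), Rem. 1.17 (p. 6)]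
[cite: JetchevSkinnerWan2017, §7.4.1 (eq:shalowerK-1) (arXiv:1512.06894 p. 30)] -/
theorem indexLowerBoundAt_of_thm120 (hKL : KrizLi2019.thm120_padicLogHeegner_unit_of_bernoulli)
    (W : WeierstrassCurve ℚ) [W.IsElliptic] [W.IsGloballyMinimal] (p : ℕ) [Fact p.Prime] (hp2 : p ≠ 2)
    (hmult : W.HasMultiplicativeReductionAtPrime p)
    (N : ℕ) [NeZero N] (K : Type) [Field K] [NumberField K]
    (Dt : ModularParametrizationData W N) (H : HeegnerDatum N (NumberField.discr K)) (ι : K →+* ℂ)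
    (ιp : K →+* ℚ_[p]) (P : (W.baseChange K).toAffine.Point)
    (hN : W.conductorNorm ℤ = N) (hK : IsImaginaryQuadratic K) (hHN : SatisfiesHeegnerHypothesis N K)
    (hPt : WeierstrassCurve.Affine.Point.map ι.toRatAlgHom P = heegnerPointComplex Dt H)
    (hcM : ¬ (p : ℤ) ∣ Dt.c)
    -- Kriz–Li's binders at `(W, p)`
    (f : ℕ) [NeZero f] (ψ : DirichletCharacter ℚ_[p] f) (ω : DirichletCharacter ℚ_[p] p)
    (hψ : ψ.IsPrimitive) (hω : KrizLi2019.IsTeichmullerCharacter ω)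
    (hss : ∀ ℓ : ℕ, ℓ.Prime → ¬ (ℓ ∣ p * W.conductorNorm ℤ) →
      ‖((W.LFunction ℓ : ℤ) : ℚ_[p]) -
          (ψ (ℓ : ZMod f) + ψ⁻¹ (ℓ : ZMod f) * ω (ℓ : ZMod p))‖ < 1)
    (h1 : ψ (p : ZMod f) ≠ 1) (h1' : KrizLi2019.primVal (KrizLi2019.invMulOmega ψ ω) p ≠ 1)
    (h2 : ∀ ℓ : ℕ, (hℓ : ℓ.Prime) →
      ¬ (haveI := Fact.mk hℓ; W.HasSplitMultiplicativeReductionAtPrime ℓ))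
    (h3 : ∀ ℓ : ℕ, (hℓ : ℓ.Prime) → ℓ ≠ p →
      (haveI := Fact.mk hℓ;
        ¬ W.HasGoodReductionAtPrime ℓ ∧ ¬ W.HasMultiplicativeReductionAtPrime ℓ) →
      ψ (ℓ : ZMod f) ≠ 1 ∧ KrizLi2019.primVal (KrizLi2019.invMulOmega ψ ω) ℓ ≠ 1)
    -- Kriz–Li's binders at `K`
    (εK : DirichletCharacter ℚ_[p] (NumberField.discr K).natAbs)
    (hεK : KrizLi2019.IsKroneckerCharacterOf K εK)
    (h4 : ¬ (‖KrizLi2019.bernoulliOnePrim (KrizLi2019.bernoulliCharOne ψ εK) *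
        KrizLi2019.bernoulliOnePrim (KrizLi2019.bernoulliCharTwo ψ εK ω)‖ ≤ (p : ℝ)⁻¹)) :
    ¬ IsOfFinAddOrder P ∧ padicValNat p (AddSubgroup.zmultiples P).index = 0 ∧
      X11b.IndexLowerBoundAt W p K P := by
  have hp : p.Prime := Fact.out
  have hp3 : 3 ≤ p := by
    rcases hp.eq_two_or_odd' with h | ⟨k, hk⟩
    · exact absurd h hp2
    · have := hp.two_le; omega
  have hns : ¬ W.HasSplitMultiplicativeReductionAtPrime p := h2 p hp
  subst hN
  haveI : NeZero (NumberField.discr K).natAbs :=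
    ⟨Int.natAbs_ne_zero.mpr (NumberField.discr_ne_zero K)⟩
  have hpN : p ∣ W.conductorNorm ℤ :=
    (W.dvd_conductorNorm_iff_not_hasGoodReductionAtPrime p).mpr
      (WeierstrassCurve.HasMultiplicativeReduction.not_hasGoodReduction (R := ℤ_[p]) hmult)
  have hsplit : ((Ideal.span {(p : ℤ)}).primesOver (𝓞 K)).ncard = 2 := hHN p hp hpN
  -- the named fact at this datum, read along `ιp`
  have hne := hKL p hp2 W f ψ ω hψ hω hss h1 h1' h2 h3 Dt K hK hHN hsplit εK hεK H ι ιp P hPt h4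
  obtain ⟨hL0, hlog⟩ :=
    padicLogOmega_ne_zero_and_padicLogOrd_le_one_of_krizLi hmult hns hcM hne
  -- `P` has infinite order: `log_{ω_𝓔}` kills exactly the torsion
  have hP : ¬ IsOfFinAddOrder P := fun hfin ↦
    hL0 (X11b.R1.logOmega_eq_padicLogOmega W p ιp P ▸ (X11b.R1.logOmega_eq_zero_iff W p ιp P).mpr hfin)
  have hidx := padicValNat_index_eq_zero_of_padicLogOrd_le_one W p hp3 hmult hns ιp P hP hlog
  exact ⟨hP, hidx, indexLowerBoundAt_of_padicValNat_index_eq_zero W p K P hidx⟩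

end StepL

/-! ## §4. PER PAIR, NON-SPLIT X2b: Mazur's MC with STEP L DISCHARGED by Kriz–Li Thm. 1.20 -/

section Door

/-- **PER PAIR, NON-SPLIT: Mazur's main conjecture at an X2b pair from a KRIZ–LI DATUM and a KL-flat partner —
STEP L (`hlow`) DISCHARGED by Kriz–Li 2019 Thm. 1.20.** The door p645525 §2
(`…KLFlatPartner.mazurMainConjectureAt_of_cellB_of_not_split_of_indexLowerBoundAt_of_klFlat_twist`) VERBATIM except
that `hlow : Finite Ш(E/K) → X11b.IndexLowerBoundAt W p K P` (item -27489 / Keller–Yin Thm. D at that datum) is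
REPLACED by Kriz–Li's binders at the same datum (`ψK`, `ωK`, `f`, trace form, (1)–(3), `ε_K`, (4), an embedding
`ι_p`) and the named fact `hKL` (§3: the Heegner point is `p`-primitive, the inequality has left side `0`; `p` is
non-split by (2)). Inputs BY NAME: `PublishedInputs`, Disegni Thm. 4(1), GV Thm. (3.11), Kriz–Li Thm. 1.20 — ALL
PUBLISHED; per pair: the twist's analytic rank (`hrd`) and a KL-flat carrier isogenous to the twist. BSD / MC proved
for no curve unconditionally. [cite: KrizLi2019, Thm. 1.20 (pp. 7–8) = Thm. 7.1 (pp. 42–43)]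
[cite: JetchevSkinnerWan2017, §7.4.1 (eq:shalowerK-1)] [cite: GreenbergVatsal2000, §3 Thm. (3.11) (p. 43) and §2 p. 28]
[cite: Disegni2020, Thm. 4 (§3.2)] [cite: Wuthrich2014, Thm. 16 (p. 397)] -/
theorem mazurMainConjectureAt_of_cellB_of_not_split_of_thm120_of_klFlat_twist
    (hP : EisensteinPrimes.PublishedInputs) (hDis : padicBSD_rankOne_nonsplitMult)
    (h311 : thm311_hasUnitContent_iff_and_order_eq_of_lineRamifiedEven)
    (hKL : KrizLi2019.thm120_padicLogHeegner_unit_of_bernoulli)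
    (W : WeierstrassCurve ℚ) [W.IsElliptic] [W.IsGloballyMinimal] (p : ℕ) [Fact p.Prime]
    (hc : X2.CellB W p)
    (N : ℕ) [NeZero N] (K : Type) [Field K] [NumberField K]
    (Dt : ModularParametrizationData W N) (H : HeegnerDatum N (NumberField.discr K)) (ι : K →+* ℂ)
    (P : (W.baseChange K).toAffine.Point)
    (hK : IsImaginaryQuadratic K) (hodd : Odd (NumberField.discr K)) (hlt : NumberField.discr K < -4)
    (hN : W.conductorNorm ℤ = N) (hHN : SatisfiesHeegnerHypothesis N K)
    (hHp : SatisfiesHeegnerHypothesis p K)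
    (hPt : WeierstrassCurve.Affine.Point.map ι.toRatAlgHom P = heegnerPointComplex Dt H)
    (hcM : ¬ (p : ℤ) ∣ Dt.c)
    (Wd : WeierstrassCurve ℚ) [Wd.IsElliptic] [Wd.IsGloballyMinimal]
    (hWd : ∃ C : VariableChange ℚ, C • Wd = W.quadraticTwist (NumberField.discr K : ℚ))
    (hrd : Wd.analyticRank = 1)
    -- Kriz–Li's binders at the datum (replace `hlow`)
    (ιp : K →+* ℚ_[p]) (f : ℕ) [NeZero f] (ψK : DirichletCharacter ℚ_[p] f) (ωK : DirichletCharacter ℚ_[p] p)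
    (hψK : ψK.IsPrimitive) (hωK : KrizLi2019.IsTeichmullerCharacter ωK)
    (hss : ∀ ℓ : ℕ, ℓ.Prime → ¬ (ℓ ∣ p * W.conductorNorm ℤ) →
      ‖((W.LFunction ℓ : ℤ) : ℚ_[p]) -
          (ψK (ℓ : ZMod f) + ψK⁻¹ (ℓ : ZMod f) * ωK (ℓ : ZMod p))‖ < 1)
    (h1 : ψK (p : ZMod f) ≠ 1) (h1' : KrizLi2019.primVal (KrizLi2019.invMulOmega ψK ωK) p ≠ 1)
    (h2 : ∀ ℓ : ℕ, (hℓ : ℓ.Prime) →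
      ¬ (haveI := Fact.mk hℓ; W.HasSplitMultiplicativeReductionAtPrime ℓ))
    (h3 : ∀ ℓ : ℕ, (hℓ : ℓ.Prime) → ℓ ≠ p →
      (haveI := Fact.mk hℓ;
        ¬ W.HasGoodReductionAtPrime ℓ ∧ ¬ W.HasMultiplicativeReductionAtPrime ℓ) →
      ψK (ℓ : ZMod f) ≠ 1 ∧ KrizLi2019.primVal (KrizLi2019.invMulOmega ψK ωK) ℓ ≠ 1)
    (εK : DirichletCharacter ℚ_[p] (NumberField.discr K).natAbs)
    (hεK : KrizLi2019.IsKroneckerCharacterOf K εK)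
    (h4 : ¬ (‖KrizLi2019.bernoulliOnePrim (KrizLi2019.bernoulliCharOne ψK εK) *
        KrizLi2019.bernoulliOnePrim (KrizLi2019.bernoulliCharTwo ψK εK ωK)‖ ≤ (p : ℝ)⁻¹))
    -- the KL-flat carrier of the twist (verbatim from the door)
    (V' : WeierstrassCurve ℚ) [V'.IsElliptic] [V'.IsGloballyMinimal] (hiso : IsIsogenous Wd V')
    (S₀ : Finset (HeightOneSpectrum (𝓞 ℚ))) (Φ₀ : AddSubgroup (V'.geomTorsion (p : ℤ)))
    (m : ℕ) [NeZero m] (φ : DirichletCharacter (ZMod p) m)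
    (d : ℕ) [NeZero d] (ψ : DirichletCharacter (ZMod p) d)
    (hΦ : IsRationalLine V' p Φ₀) (hram : ¬ LineUnramifiedAt V' p Φ₀) (heven : LineEven V' p Φ₀)
    (hφ : φ.IsPrimitive) (hψ : ψ.IsPrimitive) (hpm : p ∣ m) (hpd : ¬ p ∣ d)
    (hφ0 : ∀ (σ : absoluteGaloisGroup ℚ), ∀ Q ∈ Φ₀,
      σ • Q = (φ ((modNCyclotomicCharacter ℚ m σ : (ZMod m)ˣ) : ZMod m)).val • Q)
    (hψ0 : ∀ (σ : absoluteGaloisGroup ℚ) (Q : V'.geomTorsion (p : ℤ)),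
      σ • Q - (ψ ((modNCyclotomicCharacter ℚ d σ : (ZMod d)ˣ) : ZMod d)).val • Q ∈ Φ₀)
    (hS₀p : ∀ v ∈ S₀, ((p : ℕ) : 𝓞 ℚ) ∉ v.asIdeal)
    (hS : ∀ v : HeightOneSpectrum (𝓞 ℚ), v ∉ S₀ → ((p : ℕ) : 𝓞 ℚ) ∉ v.asIdeal → V'.HasGoodReductionAt v)
    (hC1 : ‖characterLValueC p φ ∅ 1‖ = 1) (hD1 : ‖characterLValueD p ψ ∅ 1‖ = 1)
    (hbal : 1 + ∑ v ∈ S₀, delta V' p v =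
      ∑ v ∈ S₀, ((if φ (Rat.HeightOneSpectrum.natGenerator v : ZMod m) =
            (Rat.HeightOneSpectrum.natGenerator v : ZMod p)
          then sFactor p (Rat.HeightOneSpectrum.natGenerator v) else 0) +
        (if ψ (Rat.HeightOneSpectrum.natGenerator v : ZMod d) =
            (Rat.HeightOneSpectrum.natGenerator v : ZMod p)
          then sFactor p (Rat.HeightOneSpectrum.natGenerator v) else 0))) :
    X2.MazurMainConjectureAt W p := by
  have hp : p.Prime := Fact.out
  have hp2 : p ≠ 2 := hc.2.1.1
  have hmult : W.HasMultiplicativeReductionAtPrime p := hc.2.1.2.2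
  have hns : ¬ W.HasSplitMultiplicativeReductionAtPrime p := h2 p hp
  -- STEP L at the datum, from Kriz–Li BY NAME (left side `0`)
  have hlow : Finite (W.baseChange K).sha → X11b.IndexLowerBoundAt W p K P := fun _ ↦
    (indexLowerBoundAt_of_thm120 hKL W p hp2 hmult N K Dt H ι ιp P hN hK hHN hPt hcM f ψK ωK hψK hωK hss
      h1 h1' h2 h3 εK hεK h4).2.2
  exact mazurMainConjectureAt_of_cellB_of_not_split_of_indexLowerBoundAt_of_klFlat_twist hP hDis h311 W p hc
    hns N K Dt H ι P hK hodd hlt hN hHN hHp hPt hcM Wd hWd hrd hlow V' hiso S₀ Φ₀ m φ d ψ hΦ hram heven hφ hψ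
    hpm hpd hφ0 hψ0 hS₀p hS hC1 hD1 hbal

end Door

end Summit.BirchSwinnertonDyer.BirchSwinnertonDyer.Theorems.EisensteinPrimesMazurMCOnCellBTwistbackKrizLiStepL

end
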